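import Mathlib
import HarnessLib
import Summits.ResolutionOfSingularities.ResolutionOfSingularities.Theorems.WildQuotientsWildQuotientResolutionS1aSeqRule
import Summits.ResolutionOfSingularities.ResolutionOfSingularities.Theorems.WildQuotientsWildQuotientResolutionS1aWinsOfReach

/-!
# S1a — `WinsOfSeqRule p` PROVED: the registered stub ⇐ `KillFamilyReach p ∧ AuxTopWithinReach p` (RESIDUAL OF RECORD v3, plan-1 STRATEGY-DESIGN v3.6)

[OURS · L1 W4.5c · lead-1 g8; the `Theses`-cone wrapper of `…S1aSeqRule`, target of plan-1ʼs SIG KA v3] — NOT statements of the manuscript; counted 0; AI-level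
work, weaker than expert review. Crux stmt-ResolutionOfSingularities-17941, line `s1a-logminvertex` v6, registered stub `stub_winningStrategy`.

* ★★ `winningStrategy_of_killFamilyReach_of_auxTopWithinReach : p.Prime → KillFamilyReach p → AuxTopWithinReach p → FrameWins.WinningStrategy p` —
  `wins_of_killOrAuxSeq` with `P := Reachable (initial)`; KILL half from the family form (`killHalfCoverReach_of_killFamilyReach`, p614162, and `killHalfReach_of_killHalfCoverReach`, p613609), AUX half from
  `auxAltWithin_of_auxTopWithin`;
* `WinsOfSeqRule p` (plan-1ʼs Prop, verbatim) and `winsOfSeqRule : WinsOfSeqRule p`;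
* `cyclicQuotientFourfolds_of_door_of_killFamilyReach_of_auxTopWithinReach` (door + the two research statements ⇒ the sub-crux).
-/

set_option linter.dupNamespace false

noncomputable section

open CategoryTheory Limits AlgebraicGeometry TopologicalSpace
open Literature.AlgebraicGeometry.Resolution Literature.AlgebraicGeometry.RelativeSpec
open Summit.ResolutionOfSingularities.ResolutionOfSingularities.Theorems.WildQuotientResolution.S1
open Summit.ResolutionOfSingularities.ResolutionOfSingularities.Theorems.WildQuotientResolution.S1.NodeAtlas
open Summit.ResolutionOfSingularities.ResolutionOfSingularities.Theorems.WildQuotientResolution.S1.GameFrame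
open Summit.ResolutionOfSingularities.ResolutionOfSingularities.Theorems.WildQuotientResolution.S1.KillFamily

namespace Summit.ResolutionOfSingularities.ResolutionOfSingularities.Theorems.WildQuotientResolution.S1

/-- ★★ **THE TERMINATION CRUX FROM THE RESIDUAL OF RECORD v3**: `KillFamilyReach p ∧ AuxTopWithinReach p ⇒ WinningStrategy p` (`p` prime), by the
lexicographic induction `wins_of_killOrAuxSeq` with the invariant class `P := Reachable (initial)`. [OURS · L1 W4.5c] -/
theorem winningStrategy_of_killFamilyReach_of_auxTopWithinReach {p : ℕ} (hp : p.Prime) (hK : KillFamilyReach p) (hA : AuxTopWithinReach p) :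
    FrameWins.WinningStrategy p := by
  intro k _ _ _ X' X₁ f q G _ _ ρ hG hfs hfft hfqc hX₁ _ hreg hqfin hqs hqet hq horb hdim hinj g₀ hg₀ _ h₀
  haveI := hfft
  haveI := hfqc
  haveI := hqfin
  have HK := killHalfReach_of_killHalfCoverReach hp (killHalfCoverReach_of_killFamilyReach hp hK) k X' X₁ f q G ρ hG hfs hfft hfqc hX₁ hreg hqfin
    hqs hqet hq horb hdim hinj g₀ hg₀ h₀
  have HA := hA k X' X₁ f q G ρ hG hfs hfft hfqc hX₁ hreg hqfin hqs hqet hq horb hdim hinj g₀ hg₀ h₀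
  refine GameFrame.GModel.wins_of_killOrAuxSeq hp hg₀ ((GameFrame.GModel.initial hq h₀).Reachable)
    (fun M M' 𝒦 d hR hadm hmv => GameFrame.GModel.Reachable.move 𝒦 d hR hadm hmv)
    (fun M _ => GameFrame.GModel.hasNoetherianBase_of_datum f M) (fun M _ => GameFrame.GModel.exists_nat_nu1_lt_of_datum f M)
    (fun M hR hT => ?_) (GameFrame.GModel.initial hq h₀) GameFrame.GModel.Reachable.refl
  by_cases hj : M.jInf = ⊥
  · exact Or.inl (HK M hR hT hj)
  · obtain ⟨n, hn⟩ := HA M hR hT hj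
    exact Or.inr ⟨n, GameFrame.GModel.auxAltWithin_of_auxTopWithin hp hg₀ (fun M => GameFrame.GModel.hasNoetherianBase_of_datum f M) n M hn⟩

/-- **`WinsOfSeqRule p`** (plan-1 SIG KA v3, verbatim): the game side of the residual of record v3. -/
def WinsOfSeqRule (p : ℕ) : Prop :=
  p.Prime → KillFamilyReach p → AuxTopWithinReach p → FrameWins.WinningStrategy p

/-- ★★ **`WinsOfSeqRule p` HOLDS** for every `p`. [OURS · L1 W4.5c] -/
theorem winsOfSeqRule (p : ℕ) : WinsOfSeqRule p :=
  fun hp hK hA => winningStrategy_of_killFamilyReach_of_auxTopWithinReach hp hK hA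

/-- The previous residual implies the new one on the A side (`AuxTopReach ⇒ AuxTopWithinReach`), so nothing is lost:
`KillFamilyReach p ∧ AuxTopReach p ⇒ WinningStrategy p`. [OURS · L1 W4.5c] -/
theorem winningStrategy_of_killFamilyReach_of_auxTopReach {p : ℕ} (hp : p.Prime) (hK : KillFamilyReach p) (hA : AuxTopReach p) :
    FrameWins.WinningStrategy p :=
  winningStrategy_of_killFamilyReach_of_auxTopWithinReach hp hK (auxTopWithinReach_of_auxTopReach hA)

/-- **Door + the two research statements ⇒ the sub-crux `CyclicQuotientFourfolds`.** [OURS · L1 W4.5c] -/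
theorem cyclicQuotientFourfolds_of_door_of_killFamilyReach_of_auxTopWithinReach (hD : FrameWins.DoorStatement)
    (hK : ∀ p : ℕ, p.Prime → KillFamilyReach p) (hA : ∀ p : ℕ, p.Prime → AuxTopWithinReach p) :
    Summit.ResolutionOfSingularities.ResolutionOfSingularities.Theses.WildQuotients.CyclicQuotientFourfolds :=
  FrameWins.cyclicQuotientFourfolds_of_door_of_wins hD fun p hp _ =>
    winningStrategy_of_killFamilyReach_of_auxTopWithinReach hp (hK p hp) (hA p hp)

end Summit.ResolutionOfSingularities.ResolutionOfSingularities.Theorems.WildQuotientResolution.S1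

end
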